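import Literature.NumberTheory.NumberFields.QuadraticSqrtTwoOrderFourClassNotSquare
import Literature.NumberTheory.IwasawaTheory.ClassNumberPExpLayerOneGeTwoOfOrderFourCertificate
import Literature.NumberTheory.IwasawaTheory.ClassNumberPExpLayerOneEqOneOfGenusCertificate
import HarnessLib

/-!
# `e₁ = 2` EXACTLY FROM THE BASE FIELD: `ord₂ h(K_1) = 2` for `K_1 = K(√2)` (first layer of the cyclotomic `ℤ₂`-extension of an odd-degree `K`)
# from the ORDER-FOUR CERTIFICATE in `𝓞_K` plus ONE genus bit: `q₀ ≡ ±3 (mod 𝔭₁³)` for the split prime under the order-four ideal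

`Proofs`-style file (theorems only: no definition, no named fact, no instance, no `sorry`) in topic `NumberTheory/IwasawaTheory` (namespace = path),
written by the prover seat `bsd-line-att-p4` g40 (cell `bsd-f1-sign2`, route `AlignedTransportAtTwo`; `--supports` stmt-BirchSwinnertonDyer-22298, closes
nothing).  Sequel of this seat's `ClassNumberPExpLayerOneGeTwoOfOrderFourCertificate` (`2 ≤ e₁`): with `h_K` odd, at most two primes above `2`, a dyadic
prime `𝔭₁` of norm `2`, all units `≡ ±1 (mod 𝔭₁³)` (u7) and `q₀ ≡ ±3 (mod 𝔭₁³)`, the order-four class `[(q₀, v)]` is not a square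
(`NumberFields/QuadraticSqrtTwoOrderFourClassNotSquare`, genus character at `𝔭₁`), and `rank₂ Cl(K_1) ≤ 1` (Gras, tree) gives `e₁ = 2`.

* ★★ `classNumberPExp_one_eq_two_of_orderFourCert_of_genusBit` — all data as identities / congruences in `𝓞_K` ⟹ `classNumberPExp κ 1 = 2`.
* ★★ `classNumberPExp_one_eq_two_of_orderFourCert_of_genusBit_of_rank_eq_one` — the unit hypothesis discharged from unit rank `1` and ONE unit
  `ε ≡ ±1 (mod 𝔭₁³)` with `±ε` non-squares (complex cubic fields; att-p3 g43's `forall_units_sub_one_mem_or_add_one_mem_of_rank_eq_one`).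

CELL READING (crux C2, u7 sub-cell): at every `e₁ ≥ 2` seed of att-p4 g39's census the order-four prime has `σ₁(q₀) ≡ ±3 (mod 8)`, so `e₁ = 2` exactly
(`#A(K_1) = 4`).  Nothing about any seed is asserted here; BSD is not advanced by this file.

References: [Gras2003] IV.4; [Serre1973CourseArithmetic] Ch. III §1.2 Thm. 1; [NeukirchANT1999] Ch. I §3, §7 Thm. (7.4), §8, Ch. III §1 (1.6);
[Washington1997] §13.1; [Cohen1993] §6.5.
-/

set_option autoImplicit false

noncomputable section

open scoped NumberField nonZeroDivisors
open NumberField IsDedekindDomain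

namespace Literature.NumberTheory.IwasawaTheory

open Literature.NumberTheory.EllipticCurves Literature.NumberTheory.NumberFields Literature.NumberTheory.NumberFields.AmbiguousClass
  Literature.NumberTheory.GaloisRepresentations Literature.NumberTheory.GaloisRepresentations.Herbrand
  Literature.NumberTheory.GaloisRepresentations.MinkowskiUnit Literature.NumberTheory.GaloisRepresentations.CyclicNormIndex

variable {K : Type} [Field K] [NumberField K]

/-- ★★ **`ord₂ h(K_1) = 2` from the order-four certificate plus one genus bit.**  Hypotheses of `two_le_classNumberPExp_one_of_orderFourCert`
(`K` with `2 ∤ [K:ℚ]`, `2 ∤ d_K`, a real place, `#Pl_∞(K) ≤ 2`; the `𝓞_K`-coordinate data of three units, `w`, `w*`, Bézout, `q₀ ≠ 0`, `v`, the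
`(q₀,v)² = (w,q₀²)` witnesses, the `31` residue certificates) AND: `h_K` odd, at most two primes of `K` above `2`, an ideal `𝔭₁` of norm `2`, all units
`≡ ±1 (mod 𝔭₁³)`, `N_{K_1/K}(w) = A² − 2B² = u·q₀⁴` with `u` a unit, and `q₀ ≡ ±3 (mod 𝔭₁³)`.  THEN `classNumberPExp κ 1 = 2`.
[cite: Gras2003, IV.4] [cite: NeukirchANT1999, Ch. I §7 Thm. (7.4), Ch. I §3, Ch. III §1 (1.6)] [cite: Washington1997, §13.1] [cite: Serre1973CourseArithmetic, Ch. III §1.2, Thm. 1] -/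
theorem classNumberPExp_one_eq_two_of_orderFourCert_of_genusBit (hK : ¬ 2 ∣ Module.finrank ℚ K) (hd : ¬ (2 : ℤ) ∣ NumberField.discr K)
    (hreal : 0 < NumberField.InfinitePlace.nrRealPlaces K) (hPl : Fintype.card (NumberField.InfinitePlace K) ≤ 2)
    (κ : ZpExtension K 2) (hκ : κ.IsCyclotomic) [NumberField (κ.layer 1)]
    {a₁ b₁ c₁ d₁ a₂ b₂ c₂ d₂ a₃ b₃ c₃ d₃ A B W₀ W₁ μ₀ μ₁ ν₀ ν₁ q₀ v₀ v₁ α₀ α₁ β₀ β₁ γ₀ γ₁ δ₀ δ₁ m₀ m₁ n₀ n₁ l₀ l₁ : 𝓞 K}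
    (hu₁ : a₁ * c₁ + 2 * b₁ * d₁ = 1 ∧ a₁ * d₁ + b₁ * c₁ = 0)
    (hu₂ : a₂ * c₂ + 2 * b₂ * d₂ = 1 ∧ a₂ * d₂ + b₂ * c₂ = 0)
    (hu₃ : a₃ * c₃ + 2 * b₃ * d₃ = 1 ∧ a₃ * d₃ + b₃ * c₃ = 0)
    (hws : q₀ ^ 4 = A * W₀ + 2 * B * W₁ ∧ (0 : 𝓞 K) = A * W₁ + B * W₀)
    (hbez : μ₀ * A + 2 * μ₁ * B + ν₀ * W₀ + 2 * ν₁ * W₁ = 1 ∧ μ₀ * B + μ₁ * A + ν₀ * W₁ + ν₁ * W₀ = 0)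
    (hq₀ : q₀ ≠ 0)
    (hM2 : q₀ * v₀ = α₀ * A + 2 * α₁ * B + β₀ * q₀ ^ 2 ∧ q₀ * v₁ = α₀ * B + α₁ * A + β₁ * q₀ ^ 2)
    (hM3 : v₀ ^ 2 + 2 * v₁ ^ 2 = γ₀ * A + 2 * γ₁ * B + δ₀ * q₀ ^ 2 ∧ 2 * v₀ * v₁ = γ₀ * B + γ₁ * A + δ₁ * q₀ ^ 2)
    (hM4 : A = m₀ * q₀ ^ 2 + (n₀ * (q₀ * v₀) + 2 * n₁ * (q₀ * v₁)) + (l₀ * (v₀ ^ 2 + 2 * v₁ ^ 2) + 2 * l₁ * (2 * v₀ * v₁)) ∧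
      B = m₁ * q₀ ^ 2 + (n₀ * (q₀ * v₁) + n₁ * (q₀ * v₀)) + (l₀ * (2 * v₀ * v₁) + l₁ * (v₀ ^ 2 + 2 * v₁ ^ 2)))
    (hcert : ∀ (e₁ e₂ e₃ e₄ : ℕ) (σ : ℤˣ), e₁ ≤ 1 → e₂ ≤ 1 → e₃ ≤ 1 → e₄ ≤ 1 →
      ¬ (e₁ = 0 ∧ e₂ = 0 ∧ e₃ = 0 ∧ e₄ = 0 ∧ σ = 1) →
      ∃ (q : ℕ) (ψ : 𝓞 K →+* ZMod q) (t : ZMod q) (ρ : 𝓞 K), 2 * t = 1 ∧ ψ ρ ^ 2 = 2 ∧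
        ¬ IsSquare (((σ : ℤ) : ZMod q) * (ψ a₁ + ψ b₁ * ψ ρ) ^ e₁ * (ψ a₂ + ψ b₂ * ψ ρ) ^ e₂ *
          (ψ a₃ + ψ b₃ * ψ ρ) ^ e₃ * (ψ A + ψ B * ψ ρ) ^ e₄))
    (hodd : Odd (classNumber K)) (h2le : {x : HeightOneSpectrum (𝓞 K) | ((2 : ℕ) : 𝓞 K) ∈ x.asIdeal}.ncard ≤ 2)
    (𝔭₁ : Ideal (𝓞 K)) (hN : Ideal.absNorm 𝔭₁ = 2)
    (hunits : ∀ x : (𝓞 K)ˣ, (x : 𝓞 K) - 1 ∈ 𝔭₁ ^ 3 ∨ (x : 𝓞 K) + 1 ∈ 𝔭₁ ^ 3)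
    {uw : (𝓞 K)ˣ} (hNw : A ^ 2 - 2 * B ^ 2 = (uw : 𝓞 K) * q₀ ^ 4) (hq : q₀ - 3 ∈ 𝔭₁ ^ 3 ∨ q₀ + 3 ∈ 𝔭₁ ^ 3) :
    classNumberPExp κ 1 = 2 := by
  classical
  haveI : Fact (Nat.Prime 2) := ⟨Nat.prime_two⟩
  haveI : FiniteDimensional K (κ.layer 1) := κ.finiteDimensional_layer_holds 1
  haveI : IsGalois K (κ.layer 1) := κ.isGalois_layer_holds 1
  have hdeg : Module.finrank K (κ.layer 1) = 2 := by rw [κ.finrank_layer_holds 1, pow_one]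
  -- `√2 ∈ 𝓞_{K_1} ∖ K`
  obtain ⟨s, hs⟩ := exists_sq_eq_two_layer_one_of_not_dvd_finrank hK κ hκ
  have hsK : ∀ x : K, algebraMap K (κ.layer 1) x ≠ s := forall_algebraMap_ne_of_sq_eq_two hd hs
  have hsint : IsIntegral ℤ s := by
    refine ⟨Polynomial.X ^ 2 - Polynomial.C 2, Polynomial.monic_X_pow_sub_C _ two_ne_zero, ?_⟩
    simp [hs]
  set s' : 𝓞 (κ.layer 1) := ⟨s, hsint⟩ with hs'
  have hs'2 : s' ^ 2 = 2 := by
    apply Subtype.ext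
    change ((s' ^ 2 : 𝓞 (κ.layer 1)) : κ.layer 1) = ((2 : 𝓞 (κ.layer 1)) : κ.layer 1)
    push_cast
    exact hs
  set f := algebraMap (𝓞 K) (𝓞 (κ.layer 1)) with hf
  have hcoe : ∀ z : 𝓞 K, algebraMap (𝓞 (κ.layer 1)) (κ.layer 1) (f z) = algebraMap K (κ.layer 1) (z : K) := fun z => by
    rw [hf]
    exact (IsScalarTower.algebraMap_apply (𝓞 K) (𝓞 (κ.layer 1)) (κ.layer 1) z).symm.trans
      (IsScalarTower.algebraMap_apply (𝓞 K) K (κ.layer 1) z)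
  have hcoes : algebraMap (𝓞 (κ.layer 1)) (κ.layer 1) s' = s := rfl
  have hcoord : ∀ x y : 𝓞 K, ((f x + f y * s' : 𝓞 (κ.layer 1)) : κ.layer 1) =
      algebraMap K (κ.layer 1) (x : K) + algebraMap K (κ.layer 1) (y : K) * s := fun x y => by
    rw [RingOfIntegers.coe_eq_algebraMap, map_add, map_mul, hcoe, hcoe, hcoes]
  -- the three units
  have hunit : ∀ {a b c d : 𝓞 K}, a * c + 2 * b * d = 1 ∧ a * d + b * c = 0 → (f a + f b * s') * (f c + f d * s') = 1 := by
    rintro a b c d ⟨h1, h2⟩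
    have h1' := congrArg f h1
    have h2' := congrArg f h2
    simp only [map_add, map_mul, map_ofNat, map_one, map_zero] at h1' h2'
    linear_combination h1' + s' * h2' + (f b * f d) * hs'2
  set u₁ : (𝓞 (κ.layer 1))ˣ := Units.mkOfMulEqOne _ _ (hunit hu₁) with hu₁def
  set u₂ : (𝓞 (κ.layer 1))ˣ := Units.mkOfMulEqOne _ _ (hunit hu₂) with hu₂def
  set u₃ : (𝓞 (κ.layer 1))ˣ := Units.mkOfMulEqOne _ _ (hunit hu₃) with hu₃def
  -- `w`, `w*`, `b = q₀`, `v` and the two ideal identities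
  set w : 𝓞 (κ.layer 1) := f A + f B * s' with hwdef
  set ws : 𝓞 (κ.layer 1) := f W₀ + f W₁ * s' with hwsdef
  set b : 𝓞 (κ.layer 1) := f q₀ with hbdef
  set v : 𝓞 (κ.layer 1) := f v₀ + f v₁ * s' with hvdef
  have hb0 : b ≠ 0 := by
    intro h
    apply hq₀
    have h' : algebraMap (𝓞 (κ.layer 1)) (κ.layer 1) b = 0 := by rw [h, map_zero]
    rw [hbdef, hcoe, map_eq_zero_iff _ (algebraMap K (κ.layer 1)).injective] at h'
    exact RingOfIntegers.coe_injective (by simpa using h')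
  have hmap : ∀ {x y : 𝓞 K}, x = y → f x = f y := fun h => by rw [h]
  have hI2 : (Ideal.span {b, v}) ^ 2 = Ideal.span {w, b ^ 2} := by
    refine span_pair_sq_eq_span_pair_of_witnesses (α := f α₀ + f α₁ * s') (β := f β₀ + f β₁ * s')
      (α' := f γ₀ + f γ₁ * s') (β' := f δ₀ + f δ₁ * s') (α'' := f m₀ + f m₁ * s') (β'' := f n₀ + f n₁ * s')
      (γ'' := f l₀ + f l₁ * s') ?_ ?_ ?_
    · have h1 := hmap hM2.1; have h2 := hmap hM2.2
      simp only [map_add, map_mul, map_ofNat, map_pow] at h1 h2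
      linear_combination h1 + s' * h2 + (-(f α₁ * f B)) * hs'2
    · have h1 := hmap hM3.1; have h2 := hmap hM3.2
      simp only [map_add, map_mul, map_ofNat, map_pow] at h1 h2
      linear_combination h1 + s' * h2 + ((f v₁) ^ 2 - f γ₁ * f B) * hs'2
    · have h1 := hmap hM4.1; have h2 := hmap hM4.2
      simp only [map_add, map_mul, map_ofNat, map_pow] at h1 h2
      linear_combination h1 + s' * h2 +
        (-(f n₁ * (f q₀ * f v₁)) - f l₀ * (f v₁) ^ 2 - f l₁ * (2 * f v₀ * f v₁) - s' * f l₁ * (f v₁) ^ 2) * hs'2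
  have hI4 : (Ideal.span {w, b ^ 2}) ^ 2 = Ideal.span {w} := by
    refine span_pair_sq_eq_span_singleton_of_witnesses (ws := ws) (μ := f μ₀ + f μ₁ * s') (ν := f ν₀ + f ν₁ * s') ?_ ?_
    · have h1 := hmap hws.1; have h2 := hmap hws.2
      simp only [map_add, map_mul, map_ofNat, map_pow, map_zero] at h1 h2
      linear_combination h1 + s' * h2 + (-(f B * f W₁)) * hs'2
    · have h1 := hmap hbez.1; have h2 := hmap hbez.2
      simp only [map_add, map_mul, map_ofNat, map_one, map_zero] at h1 h2
      linear_combination h1 + s' * h2 + (f μ₁ * f B + f ν₁ * f W₁) * hs'2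
  have hu₁c : (((u₁ : 𝓞 (κ.layer 1))) : κ.layer 1) = algebraMap K (κ.layer 1) (a₁ : K) + algebraMap K (κ.layer 1) (b₁ : K) * s := by
    rw [hu₁def, Units.val_mkOfMulEqOne]; exact hcoord a₁ b₁
  have hu₂c : (((u₂ : 𝓞 (κ.layer 1))) : κ.layer 1) = algebraMap K (κ.layer 1) (a₂ : K) + algebraMap K (κ.layer 1) (b₂ : K) * s := by
    rw [hu₂def, Units.val_mkOfMulEqOne]; exact hcoord a₂ b₂
  have hu₃c : (((u₃ : 𝓞 (κ.layer 1))) : κ.layer 1) = algebraMap K (κ.layer 1) (a₃ : K) + algebraMap K (κ.layer 1) (b₃ : K) * s := by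
    rw [hu₃def, Units.val_mkOfMulEqOne]; exact hcoord a₃ b₃
  have h4 := four_dvd_card_classGroup_of_orderFourCert hdeg hs hsK hreal hPl u₁ u₂ u₃
    (a₁ := a₁) (b₁ := b₁) (a₂ := a₂) (b₂ := b₂) (a₃ := a₃) (b₃ := b₃) (A := A) (B := B) hu₁c hu₂c hu₃c (hcoord A B) hb0 hI2 hI4 hcert
  -- the dyadic prime `𝔭₁` and `rank₂ Cl(K_1) ≤ 1` (Gras)
  obtain ⟨h𝔭₁, hP0, h2P, hcard⟩ := isPrime_and_mem_of_absNorm_eq_two 𝔭₁ hN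
  haveI := h𝔭₁
  haveI : 𝔭₁.IsMaximal := h𝔭₁.isMaximal hP0
  have hres := forall_mem_or_sub_one_mem_of_card_quotient_eq_two 𝔭₁ hcard
  have h2P' : (2 : 𝓞 K) ∉ 𝔭₁ ^ 2 := two_not_mem_sq_of_not_dvd_discr hd 𝔭₁ h2P
  have hgras := classGroupPRank_one_add_one_add_padicValNat_eq_ncard κ hodd
  have ht := ncard_ramified_layer_le_of_ncard_eq κ 1 (s := {x : HeightOneSpectrum (𝓞 K) | ((2 : ℕ) : 𝓞 K) ∈ x.asIdeal}.ncard) rfl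
  have hr1 : classGroupPRank κ 1 ≤ 1 := by omega
  have hrank := natCard_quotient_le_two_of_classGroupPRank_le_one κ 1 hr1
  -- `N_{K_1/K}(w) = uw q₀⁴`
  have hNw' : Algebra.intNorm (𝓞 K) (𝓞 (κ.layer 1)) w = (uw : 𝓞 K) * q₀ ^ 4 := by
    have h1 : ((Algebra.intNorm (𝓞 K) (𝓞 (κ.layer 1)) w : 𝓞 K) : K) = Algebra.norm K (w : κ.layer 1) :=
      Algebra.algebraMap_intNorm (A := 𝓞 K) (K := K) (L := κ.layer 1) (B := 𝓞 (κ.layer 1)) w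
    apply RingOfIntegers.coe_injective
    change ((Algebra.intNorm (𝓞 K) (𝓞 (κ.layer 1)) w : 𝓞 K) : K) = ((((uw : 𝓞 K) * q₀ ^ 4 : 𝓞 K)) : K)
    rw [h1, hwdef, hcoord A B, Algebra.norm_add_mul_eq_sq_sub_two_mul_sq hdeg hs hsK, ← hNw]
    push_cast
    simp only [RingOfIntegers.coe_eq_algebraMap, map_ofNat]
  rw [classNumberPExp_def]
  exact padicValNat_two_card_classGroup_eq_two_of_genusBit hdeg hs hsK hodd 𝔭₁ hP0 hres h2P h2P' hunits hrank h4 hb0 hI2 hI4 hNw' hq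

/-- ★★ **The same for a field of unit rank one** (complex cubic fields): the unit hypothesis discharged from `rank K = 1` and ONE unit
`ε ≡ ±1 (mod 𝔭₁³)` such that neither `ε` nor `−ε` is the square of a unit. [cite: Gras2003, IV.4] [cite: NeukirchANT1999, Ch. I §7 Thm. (7.4)]
[cite: Serre1973CourseArithmetic, Ch. III §1.2, Thm. 1] -/
theorem classNumberPExp_one_eq_two_of_orderFourCert_of_genusBit_of_rank_eq_one (hK : ¬ 2 ∣ Module.finrank ℚ K)
    (hd : ¬ (2 : ℤ) ∣ NumberField.discr K)
    (hreal : 0 < NumberField.InfinitePlace.nrRealPlaces K) (hPl : Fintype.card (NumberField.InfinitePlace K) ≤ 2)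
    (κ : ZpExtension K 2) (hκ : κ.IsCyclotomic) [NumberField (κ.layer 1)]
    {a₁ b₁ c₁ d₁ a₂ b₂ c₂ d₂ a₃ b₃ c₃ d₃ A B W₀ W₁ μ₀ μ₁ ν₀ ν₁ q₀ v₀ v₁ α₀ α₁ β₀ β₁ γ₀ γ₁ δ₀ δ₁ m₀ m₁ n₀ n₁ l₀ l₁ : 𝓞 K}
    (hu₁ : a₁ * c₁ + 2 * b₁ * d₁ = 1 ∧ a₁ * d₁ + b₁ * c₁ = 0)
    (hu₂ : a₂ * c₂ + 2 * b₂ * d₂ = 1 ∧ a₂ * d₂ + b₂ * c₂ = 0)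
    (hu₃ : a₃ * c₃ + 2 * b₃ * d₃ = 1 ∧ a₃ * d₃ + b₃ * c₃ = 0)
    (hws : q₀ ^ 4 = A * W₀ + 2 * B * W₁ ∧ (0 : 𝓞 K) = A * W₁ + B * W₀)
    (hbez : μ₀ * A + 2 * μ₁ * B + ν₀ * W₀ + 2 * ν₁ * W₁ = 1 ∧ μ₀ * B + μ₁ * A + ν₀ * W₁ + ν₁ * W₀ = 0)
    (hq₀ : q₀ ≠ 0)
    (hM2 : q₀ * v₀ = α₀ * A + 2 * α₁ * B + β₀ * q₀ ^ 2 ∧ q₀ * v₁ = α₀ * B + α₁ * A + β₁ * q₀ ^ 2)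
    (hM3 : v₀ ^ 2 + 2 * v₁ ^ 2 = γ₀ * A + 2 * γ₁ * B + δ₀ * q₀ ^ 2 ∧ 2 * v₀ * v₁ = γ₀ * B + γ₁ * A + δ₁ * q₀ ^ 2)
    (hM4 : A = m₀ * q₀ ^ 2 + (n₀ * (q₀ * v₀) + 2 * n₁ * (q₀ * v₁)) + (l₀ * (v₀ ^ 2 + 2 * v₁ ^ 2) + 2 * l₁ * (2 * v₀ * v₁)) ∧
      B = m₁ * q₀ ^ 2 + (n₀ * (q₀ * v₁) + n₁ * (q₀ * v₀)) + (l₀ * (2 * v₀ * v₁) + l₁ * (v₀ ^ 2 + 2 * v₁ ^ 2)))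
    (hcert : ∀ (e₁ e₂ e₃ e₄ : ℕ) (σ : ℤˣ), e₁ ≤ 1 → e₂ ≤ 1 → e₃ ≤ 1 → e₄ ≤ 1 →
      ¬ (e₁ = 0 ∧ e₂ = 0 ∧ e₃ = 0 ∧ e₄ = 0 ∧ σ = 1) →
      ∃ (q : ℕ) (ψ : 𝓞 K →+* ZMod q) (t : ZMod q) (ρ : 𝓞 K), 2 * t = 1 ∧ ψ ρ ^ 2 = 2 ∧
        ¬ IsSquare (((σ : ℤ) : ZMod q) * (ψ a₁ + ψ b₁ * ψ ρ) ^ e₁ * (ψ a₂ + ψ b₂ * ψ ρ) ^ e₂ *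
          (ψ a₃ + ψ b₃ * ψ ρ) ^ e₃ * (ψ A + ψ B * ψ ρ) ^ e₄))
    (hodd : Odd (classNumber K)) (h2le : {x : HeightOneSpectrum (𝓞 K) | ((2 : ℕ) : 𝓞 K) ∈ x.asIdeal}.ncard ≤ 2)
    (hrank : Units.rank K = 1) (𝔭₁ : Ideal (𝓞 K)) (hN : Ideal.absNorm 𝔭₁ = 2) {ε : (𝓞 K)ˣ}
    (hε : (ε : 𝓞 K) - 1 ∈ 𝔭₁ ^ 3 ∨ (ε : 𝓞 K) + 1 ∈ 𝔭₁ ^ 3) (hnsq : ∀ y : (𝓞 K)ˣ, ε ≠ y ^ 2 ∧ ε ≠ -y ^ 2)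
    {uw : (𝓞 K)ˣ} (hNw : A ^ 2 - 2 * B ^ 2 = (uw : 𝓞 K) * q₀ ^ 4) (hq : q₀ - 3 ∈ 𝔭₁ ^ 3 ∨ q₀ + 3 ∈ 𝔭₁ ^ 3) :
    classNumberPExp κ 1 = 2 := by
  obtain ⟨h𝔭₁, hP0, h2P, hcard⟩ := isPrime_and_mem_of_absNorm_eq_two 𝔭₁ hN
  haveI := h𝔭₁
  haveI : 𝔭₁.IsMaximal := h𝔭₁.isMaximal hP0
  have hres := forall_mem_or_sub_one_mem_of_card_quotient_eq_two 𝔭₁ hcard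
  have h2P' : (2 : 𝓞 K) ∉ 𝔭₁ ^ 2 := two_not_mem_sq_of_not_dvd_discr hd 𝔭₁ h2P
  have hoddK : Odd (Module.finrank ℚ K) := Nat.odd_iff.mpr (Nat.two_dvd_ne_zero.mp hK)
  have hunits := forall_units_sub_one_mem_or_add_one_mem_of_rank_eq_one hoddK hrank 𝔭₁ hP0 hres h2P h2P' hε hnsq
  exact classNumberPExp_one_eq_two_of_orderFourCert_of_genusBit hK hd hreal hPl κ hκ hu₁ hu₂ hu₃ hws hbez hq₀ hM2 hM3 hM4 hcert
    hodd h2le 𝔭₁ hN hunits hNw hq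

end Literature.NumberTheory.IwasawaTheory

end
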